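import Summits.CriticalPhenomena.SAWScalingLimit.Theorems.SAWLoopFugacityFlowLimitAvoidanceValuesExplicit
import HarnessLib

/-!
# `SAWLoopFugacityFlow.LimitAvoidanceValues` (stmt-CriticalPhenomena-18170): the two ONE-SIDED halves

The item (hull-avoidance values `Φ_A'(0)^{5/8}` of every subsequential weak limit `ν` of the
pushed-forward critical SAW laws) is fed, inside its routes, by two-sided hull-avoidance LIMITS on the
lattice (`AvoidanceLimit`, stmt-CriticalPhenomena-10649, or `limitAvoidanceValues_of_seqAvoidanceLimit`).
Here that input is split into its one-sided halves, EACH passing to the limit on its own, asymmetrically: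

* `le_measure_of_le_liminf` — **lower half, local**: `v ≤ liminf Pₙ(C)` for ONE closed event `C` gives
  `v ≤ ν(C)` (portmanteau, `portmanteau`); so `Φ_A'(0)^{5/8} ≤ liminf Pₙ(range ⊆ cl D')` for the single
  `D'` gives `Φ_A'(0)^{5/8} ≤ ν(range ⊆ cl D')`;
* `measure_rangeSubset_le_of_limsup_le` — **upper half, needs a family**: `limsup Pₙ(range ⊆ cl D'') ≤
  μ(range ⊆ cl D'')` against the SLE_(8/3) law `μ` for the inline hull subdomains `D''` gives
  `ν(range ⊆ cl D') ≤ μ(range ⊆ cl D')` for EVERY Dobrushin `D' ⊆ D` with the same marked points: the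
  carving half of `avoidancePassage_proof` (stmt-CriticalPhenomena-4984) re-run with `limsup` for `lim`
  and with the confinement `Pₙ(range ⊄ cl D) = 0` taken from the lattice
  (`Negative.curve_range_subset_closure`) instead of from the hypothesis at `D'' = D`;
* `limitAvoidanceValues_of_oneSided` — the item from the two one-sided SEQUENTIAL lattice bounds along
  weakly convergent sequences; `oneSided_of_avoidanceLimit` — both bounds from `AvoidanceLimit`.

References: G. F. Lawler, O. Schramm, W. Werner, *Conformal restriction: the chordal case*, J. Amer.
Math. Soc. 16 (2003), §3, Thm. 6.1; P. Billingsley, *Convergence of Probability Measures* (1999), Thm. 2.1.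
-/

noncomputable section

open MeasureTheory Filter Topology Set Metric
open Literature.Probability.RandomPlanarGeometry Literature.Probability.RandomPlanarGeometry.SAW
open Literature.Probability.LatticeModels
open UpperHalfPlane (upperHalfPlaneSet)
open scoped ENNReal NNReal BoundedContinuousFunction

namespace Summit.CriticalPhenomena.SAWScalingLimit.Theorems.LimitAvoidanceValues

open Summit.CriticalPhenomena.SAWScalingLimit.Theses.SAWLoopFugacityFlow
  (LimitAvoidanceValues AvoidanceLimit)
open Summit.CriticalPhenomena.SAWScalingLimit.Theorems (SLEAvoidanceValue_proof)
open Summit.CriticalPhenomena.SAWScalingLimit.Theorems.SimpleSubseqLimits.Negative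
  (curve_range_subset_closure eventually_ne_of_isEndpointApprox
    eventually_isProbabilityMeasure_of_weakLimitAlong)

variable {D : DobrushinDomain} {a b : ℝ → Site 2} {s : ℕ → ℝ} {ν : Measure (CurveClass ℂ)}

/-! ## §1 Portmanteau for the pushed-forward SAW laws -/

/-- **Portmanteau for the pushed-forward SAW laws.** Along a weakly convergent sequence of critical
SAW laws, `limsup Pₙ(C) ≤ ν(C)` for closed `C` and `ν(G) ≤ liminf Pₙ(G)` for open `G` (the laws are
probability measures eventually, by honesty of the weak limit,
`Negative.eventually_isProbabilityMeasure_of_weakLimitAlong`). [cite: BillingsleyCPM1999, Thm. 2.1] -/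
theorem portmanteau [IsProbabilityMeasure ν]
    (hw : ∀ f : CurveClass ℂ →ᵇ ℝ,
      Tendsto (fun n => ∫ γ, f γ.curve ∂(SAW.law D.carrier (s n) (a (s n)) (b (s n)))) atTop
        (𝓝 (∫ x, f x ∂ν))) :
    (∀ C : Set (CurveClass ℂ), IsClosed C →
      limsup (fun n => ((SAW.law D.carrier (s n) (a (s n)) (b (s n))).map (fun γ => γ.curve)) C)
        atTop ≤ ν C) ∧
    (∀ G : Set (CurveClass ℂ), IsOpen G →
      ν G ≤ liminf (fun n => ((SAW.law D.carrier (s n) (a (s n)) (b (s n))).map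
        (fun γ => γ.curve)) G) atTop) := by
  classical
  set P : ℕ → Measure (CurveClass ℂ) := fun n ↦
    (SAW.law D.carrier (s n) (a (s n)) (b (s n))).map (fun γ ↦ γ.curve) with hP
  have hmeas : ∀ n, Measurable
      (fun γ : SAW.DomainSAW D.carrier (s n) (a (s n)) (b (s n)) ↦ γ.curve) := fun n ↦
    SAW.DomainSAW.measurable_of_top _
  have hweakP : ∀ f : CurveClass ℂ →ᵇ ℝ,
      Tendsto (fun n ↦ ∫ x, f x ∂(P n)) atTop (𝓝 (∫ x, f x ∂ν)) := fun f ↦ by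
    have hint : ∀ n, ∫ x, f x ∂(P n) =
        ∫ γ, f γ.curve ∂(SAW.law D.carrier (s n) (a (s n)) (b (s n))) := fun n ↦
      integral_map (hmeas n).aemeasurable f.continuous.aestronglyMeasurable
    simp only [hint]
    exact hw f
  have hevP : ∀ᶠ n in atTop, IsProbabilityMeasure (P n) := by
    filter_upwards [eventually_isProbabilityMeasure_of_weakLimitAlong (D := D) (a := a) (b := b)
      (s := s) (ν := ν) hw] with n hn
    haveI := hn.1
    exact Measure.isProbabilityMeasure_map (hmeas n).aemeasurable
  let Q : ℕ → ProbabilityMeasure (CurveClass ℂ) := fun n ↦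
    if h : IsProbabilityMeasure (P n) then (⟨P n, h⟩ : ProbabilityMeasure (CurveClass ℂ))
    else (⟨ν, inferInstance⟩ : ProbabilityMeasure (CurveClass ℂ))
  have hQP : ∀ᶠ n in atTop, (Q n : Measure (CurveClass ℂ)) = P n := by
    filter_upwards [hevP] with n hn
    simp only [Q, dif_pos hn, ProbabilityMeasure.coe_mk]
  have hQlim : Tendsto Q atTop (𝓝 (⟨ν, inferInstance⟩ : ProbabilityMeasure (CurveClass ℂ))) := by
    rw [ProbabilityMeasure.tendsto_iff_forall_integral_tendsto]
    intro f
    refine (hweakP f).congr' ?_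
    filter_upwards [hQP] with n hn
    rw [hn]
  refine ⟨fun C hC ↦ ?_, fun G hG ↦ ?_⟩
  · have h := ProbabilityMeasure.limsup_measure_closed_le_of_tendsto hQlim hC
    have heq : (fun n ↦ P n C) =ᶠ[atTop] fun n ↦ (Q n : Measure (CurveClass ℂ)) C :=
      hQP.mono fun n hn ↦ by simp only [hn]
    rw [limsup_congr heq]
    exact h
  · have h := ProbabilityMeasure.le_liminf_measure_open_of_tendsto hQlim hG
    have heq : (fun n ↦ P n G) =ᶠ[atTop] fun n ↦ (Q n : Measure (CurveClass ℂ)) G :=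
      hQP.mono fun n hn ↦ by simp only [hn]
    rw [liminf_congr heq]
    exact h

/-- **Confinement is free on the lattice**: along an endpoint approximation the pushed-forward SAW
law gives mass `0` to `{range ⊄ cl D}` for all large `n` (the endpoints are eventually distinct, and
a SAW polyline between distinct vertices lies in `cl D`, `Negative.curve_range_subset_closure`).
[folklore] -/
theorem eventually_map_compl_rangeSubset_eq_zero (hab : IsEndpointApprox D a b)
    (hs : Tendsto s atTop (𝓝[>] (0 : ℝ))) :
    ∀ᶠ n in atTop, ((SAW.law D.carrier (s n) (a (s n)) (b (s n))).map (fun γ => γ.curve))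
      (CurveClass.rangeSubset (closure D.carrier))ᶜ = 0 := by
  filter_upwards [eventually_ne_of_isEndpointApprox hab hs] with n hn
  rw [Measure.map_apply (SAW.DomainSAW.measurable_of_top _)
    (CurveClass.measurableSet_rangeSubset isClosed_closure).compl]
  have : (fun γ : SAW.DomainSAW D.carrier (s n) (a (s n)) (b (s n)) => γ.curve) ⁻¹'
      (CurveClass.rangeSubset (closure D.carrier))ᶜ = ∅ :=
    eq_empty_of_forall_notMem fun γ hγ => hγ (curve_range_subset_closure hn γ)
  rw [this, measure_empty]

/-! ## §2 The lower half is local -/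

/-- **LOWER HALF (local).** A lower bound for the `liminf` of the SAW probabilities of ONE closed
event `C` along a weakly convergent sequence is a lower bound for its `ν`-mass:
`v ≤ liminf Pₙ(C) ≤ limsup Pₙ(C) ≤ ν(C)`. [cite: BillingsleyCPM1999, Thm. 2.1] -/
theorem le_measure_of_le_liminf [IsProbabilityMeasure ν]
    (hw : ∀ f : CurveClass ℂ →ᵇ ℝ,
      Tendsto (fun n => ∫ γ, f γ.curve ∂(SAW.law D.carrier (s n) (a (s n)) (b (s n)))) atTop
        (𝓝 (∫ x, f x ∂ν)))
    {C : Set (CurveClass ℂ)} (hC : IsClosed C) {v : ℝ≥0∞}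
    (hv : v ≤ liminf (fun n => ((SAW.law D.carrier (s n) (a (s n)) (b (s n))).map
      (fun γ => γ.curve)) C) atTop) :
    v ≤ ν C :=
  hv.trans ((liminf_le_limsup).trans ((portmanteau hw).1 C hC))

/-! ## §3 The upper half needs the carved super-domains -/

/-- **UPPER HALF (carving).** Let `ν` be a subsequential weak limit of the pushed-forward critical
SAW laws of `(D; a, b)` and `μ` an SLE_(8/3) law of `D`. If `limsup Pₙ(range ⊆ cl D'') ≤ μ(range ⊆ cl D'')`
for every inline hull subdomain `D''` (same marked points, ball agreement near them), then
`ν(range ⊆ cl D') ≤ μ(range ⊆ cl D')` for EVERY Dobrushin `D' ⊆ D` with the same marked points.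
Proof: the `ν ≤ μ` half of `avoidancePassage_proof` — exhaust `D ∖ cl D'` by compacts `K_k`, carve
hull super-domains `D''_k = D ∖ T_k ⊇ D'` missing `K_k` (`AvoidancePassage.exists_superdomain`), and
bound `ν(F) ≤ ν(range ⊆ T_kᶜ) ≤ liminf Pₙ(range ⊆ T_kᶜ) ≤ limsup Pₙ(F_k) ≤ μ(F_k) → μ(F)`, using that
lattice curves lie in `cl D` (`eventually_map_compl_rangeSubset_eq_zero`) and that `μ`-a.e. curve
has range in `D ∪ {a, b}` (Rohde–Schramm, Carathéodory — theorems of the tree).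
[cite: LawlerSchrammWerner2003Restriction, §3] -/
theorem measure_rangeSubset_le_of_limsup_le (hab : IsEndpointApprox D a b)
    (hs : Tendsto s atTop (𝓝[>] (0 : ℝ))) [hν : IsProbabilityMeasure ν]
    (hw : ∀ f : CurveClass ℂ →ᵇ ℝ,
      Tendsto (fun n => ∫ γ, f γ.curve ∂(SAW.law D.carrier (s n) (a (s n)) (b (s n)))) atTop
        (𝓝 (∫ x, f x ∂ν)))
    {μ : Measure (CurveClass ℂ)} (hμ : IsSLELaw ((8 : ℝ≥0) / 3) D μ)
    (hup : ∀ D'' : DobrushinDomain, D''.carrier ⊆ D.carrier → D''.pt 0 = D.pt 0 →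
      D''.pt 1 = D.pt 1 →
      (∃ ε : ℝ, 0 < ε ∧ D''.carrier ∩ ball (D.pt 0) ε = D.carrier ∩ ball (D.pt 0) ε ∧
        D''.carrier ∩ ball (D.pt 1) ε = D.carrier ∩ ball (D.pt 1) ε) →
      limsup (fun n => ((SAW.law D.carrier (s n) (a (s n)) (b (s n))).map (fun γ => γ.curve))
        (CurveClass.rangeSubset (closure D''.carrier))) atTop ≤
        μ (CurveClass.rangeSubset (closure D''.carrier)))
    {D' : DobrushinDomain} (hD'sub : D'.carrier ⊆ D.carrier) (h0 : D'.pt 0 = D.pt 0)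
    (h1 : D'.pt 1 = D.pt 1) :
    ν (CurveClass.rangeSubset (closure D'.carrier)) ≤
      μ (CurveClass.rangeSubset (closure D'.carrier)) := by
  classical
  haveI : Fact Literature.Probability.Process.isProjectiveLimit_preWienerMeasure :=
    ⟨isProjectiveLimit_preWienerMeasure_holds⟩
  haveI hμP : IsProbabilityMeasure μ := hμ.isProbabilityMeasure
  set P : ℕ → Measure (CurveClass ℂ) := fun n ↦
    (SAW.law D.carrier (s n) (a (s n)) (b (s n))).map (fun γ ↦ γ.curve) with hP
  set F : Set (CurveClass ℂ) := CurveClass.rangeSubset (closure D'.carrier) with hF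
  have hFm : MeasurableSet F := CurveClass.measurableSet_rangeSubset isClosed_closure
  have hopen : ∀ G : Set (CurveClass ℂ), IsOpen G → ν G ≤ liminf (fun n ↦ P n G) atTop :=
    (portmanteau hw).2
  set S : Set (CurveClass ℂ) := CurveClass.rangeSubset (closure D.carrier) with hS
  have hSc : ∀ᶠ n in atTop, P n Sᶜ = 0 := eventually_map_compl_rangeSubset_eq_zero hab hs
  -- `μ`-a.e. regularity of the SLE(8/3) law
  have hae : ∀ᵐ γ ∂μ, γ.range ⊆ closure D.carrier ∧
      γ.range ∩ frontier D.carrier ⊆ {D.pt 0, D.pt 1} := by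
    have h83 : (0 : ℝ≥0) < 8 / 3 := by positivity
    have h83' : ((8 : ℝ≥0) / 3) ≤ 4 := by
      rw [div_le_iff₀ (by norm_num : (0 : ℝ≥0) < 3)]
      norm_num
    filter_upwards [hμ.ae_endpoints JordanDomain.mapsTo_boundaryExtension_holds,
      hμ.ae_simple ae_isSimpleTrace_sleTrace_of_le_four_holds CurveClass.measurableSet_simple_holds
        h83 h83'] with γ hγ hγ'
    exact ⟨hγ.2.2, hγ'.2⟩
  -- exhaustion of `O = D ∖ cl D'` by compacts
  set O : Set ℂ := D.carrier \ closure D'.carrier with hO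
  have hOo : IsOpen O := D.isOpen.sdiff isClosed_closure
  have hOc : (Oᶜ).Nonempty := by
    obtain ⟨z, hz⟩ : (D.carrierᶜ).Nonempty := nonempty_compl.2 D.carrier_ne_univ
    exact ⟨z, fun hzO ↦ hz hzO.1⟩
  set K : ℕ → Set ℂ := fun k ↦ {z | 1 / ((k : ℝ) + 1) ≤ infDist z Oᶜ} with hK
  have hKO : ∀ k, K k ⊆ O := fun k z hz ↦ by
    by_contra hzO
    have hd : infDist z Oᶜ = 0 := infDist_zero_of_mem hzO
    have hpos : (0 : ℝ) < 1 / ((k : ℝ) + 1) := by positivity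
    have hz' : 1 / ((k : ℝ) + 1) ≤ infDist z Oᶜ := hz
    linarith
  have hKc : ∀ k, IsCompact (K k) := fun k ↦
    Metric.isCompact_of_isClosed_isBounded (isClosed_le continuous_const (continuous_infDist_pt _))
      (D.isBounded.subset ((hKO k).trans Set.sdiff_subset))
  have hKint : ∀ z ∈ O, ∃ k₀ : ℕ, ∀ k, k₀ ≤ k → z ∈ interior (K k) := by
    intro z hz
    have hd : 0 < infDist z Oᶜ :=
      (hOo.isClosed_compl.notMem_iff_infDist_pos hOc).1 fun h ↦ h hz
    obtain ⟨k₀, hk₀⟩ := exists_nat_one_div_lt hd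
    refine ⟨k₀, fun k hk ↦ ?_⟩
    have hsub : {w : ℂ | 1 / ((k : ℝ) + 1) < infDist w Oᶜ} ⊆ K k := fun w hw ↦
      show 1 / ((k : ℝ) + 1) ≤ infDist w Oᶜ from le_of_lt hw
    apply interior_mono hsub
    rw [(isOpen_lt continuous_const (continuous_infDist_pt _)).interior_eq]
    show 1 / ((k : ℝ) + 1) < infDist z Oᶜ
    have hk' : (k₀ : ℝ) + 1 ≤ (k : ℝ) + 1 := by exact_mod_cast Nat.add_le_add_right hk 1
    calc 1 / ((k : ℝ) + 1) ≤ 1 / ((k₀ : ℝ) + 1) := one_div_le_one_div_of_le (by positivity) hk'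
      _ < infDist z Oᶜ := hk₀
  have hsup : ∀ k, ∃ (E : DobrushinDomain) (T : Set ℂ), IsClosed T ∧
      Disjoint T (closure D'.carrier) ∧ E.carrier = D.carrier \ T ∧ E.pt 0 = D.pt 0 ∧
      E.pt 1 = D.pt 1 ∧ Disjoint E.carrier (K k) := fun k ↦
    AvoidancePassage.exists_superdomain D D' hD'sub h0 h1 (hKc k)
      ((hKO k).trans Set.sdiff_subset) (Set.disjoint_left.2 fun z hz hzc ↦ (hKO k hz).2 hzc)
  choose E T hTcl hTD' hEcar hE0 hE1 hEK using hsup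
  have hptcl : ∀ i, D.pt i ∈ closure D'.carrier := by
    intro i
    fin_cases i
    · exact frontier_subset_closure (h0 ▸ D'.pt_mem_frontier 0)
    · exact frontier_subset_closure (h1 ▸ D'.pt_mem_frontier 1)
  have hptT : ∀ k i, D.pt i ∉ T k := fun k i h ↦ Set.disjoint_left.1 (hTD' k) h (hptcl i)
  set Fk : ℕ → Set (CurveClass ℂ) := fun k ↦ CurveClass.rangeSubset (closure (E k).carrier)
    with hFk
  have hFkm : ∀ k, MeasurableSet (Fk k) := fun k ↦
    CurveClass.measurableSet_rangeSubset isClosed_closure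
  have hadm : ∀ k, limsup (fun n ↦ P n (Fk k)) atTop ≤ μ (Fk k) := fun k ↦
    hup (E k) (by rw [hEcar k]; exact Set.sdiff_subset) (hE0 k) (hE1 k)
      (AvoidancePassage.exists_ball_inter_eq D (E k) (hTcl k) (hEcar k) (hptT k 0) (hptT k 1))
  have hνle : ∀ k, ν F ≤ μ (Fk k) := by
    intro k
    set G : Set (CurveClass ℂ) := CurveClass.rangeSubset (T k)ᶜ with hG
    have hGo : IsOpen G := CurveClass.isOpen_rangeSubset (hTcl k).isOpen_compl
    have hFG : F ⊆ G := fun γ hγ ↦ (show γ.range ⊆ closure D'.carrier from hγ).trans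
      fun z hz hzT ↦ Set.disjoint_left.1 (hTD' k) hzT hz
    have hGS : G ∩ S ⊆ Fk k := by
      rintro γ ⟨hγG, hγS⟩
      show γ.range ⊆ closure (E k).carrier
      rw [hEcar k]
      intro z hz
      have h' : z ∈ closure D.carrier ∩ (T k)ᶜ := ⟨hγS hz, hγG hz⟩
      exact (hTcl k).isOpen_compl.closure_inter h'
    have hev : ∀ᶠ n in atTop, P n G ≤ P n (Fk k) := by
      filter_upwards [hSc] with n hn
      calc P n G ≤ P n (G ∩ S ∪ Sᶜ) := measure_mono fun γ hγ ↦ by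
              by_cases h : γ ∈ S
              · exact Or.inl ⟨hγ, h⟩
              · exact Or.inr h
        _ ≤ P n (G ∩ S) + P n Sᶜ := measure_union_le _ _
        _ = P n (G ∩ S) := by rw [hn, add_zero]
        _ ≤ P n (Fk k) := measure_mono hGS
    calc ν F ≤ ν G := measure_mono hFG
      _ ≤ liminf (fun n ↦ P n G) atTop := hopen G hGo
      _ ≤ liminf (fun n ↦ P n (Fk k)) atTop := liminf_le_liminf hev
      _ ≤ limsup (fun n ↦ P n (Fk k)) atTop := liminf_le_limsup
      _ ≤ μ (Fk k) := hadm k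
  -- `μ F_k → μ F`: the limsup of the differences is `μ`-null
  set A : ℕ → Set (CurveClass ℂ) := fun k ↦ ⋃ j, ⋃ (_ : k ≤ j), (Fk j \ F) with hA
  have hAm : ∀ k, MeasurableSet (A k) := fun k ↦
    MeasurableSet.iUnion fun j ↦ MeasurableSet.iUnion fun _ ↦ (hFkm j).diff hFm
  have hAanti : Antitone A := fun j k hjk ↦ iUnion₂_subset fun i hi ↦
    subset_iUnion₂ (s := fun i (_ : j ≤ i) ↦ Fk i \ F) i (hjk.trans hi)
  have hAnull : μ (⋂ k, A k) = 0 := by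
    refine measure_mono_null ?_ (ae_iff.1 hae)
    intro γ hγ hgood
    obtain ⟨hγD, hγfr⟩ := hgood
    obtain ⟨j₀, -, hγj₀⟩ := mem_iUnion₂.1 (mem_iInter.1 hγ 0)
    have hγF : γ ∉ F := hγj₀.2
    obtain ⟨z, hz, hzD'⟩ : ∃ z ∈ γ.range, z ∉ closure D'.carrier := by
      by_contra h
      push Not at h
      exact hγF h
    have hzD : z ∈ D.carrier := by
      have hzcl := hγD hz
      rw [closure_eq_self_union_frontier] at hzcl
      rcases hzcl with h | h
      · exact h
      · exfalso
        have hmem : z ∈ ({D.pt 0, D.pt 1} : Set ℂ) := hγfr ⟨hz, h⟩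
        rcases hmem with h' | h'
        · exact hzD' (h' ▸ hptcl 0)
        · exact hzD' (h' ▸ hptcl 1)
    obtain ⟨k₀, hk₀⟩ := hKint z ⟨hzD, hzD'⟩
    obtain ⟨j, hj, hγj⟩ := mem_iUnion₂.1 (mem_iInter.1 hγ k₀)
    have hzint : z ∈ interior (K j) := hk₀ j hj
    have hzE : z ∈ closure (E j).carrier := hγj.1 hz
    have hdis : Disjoint (closure (E j).carrier) (interior (K j)) :=
      ((hEK j).mono_right interior_subset).closure_left isOpen_interior
    exact Set.disjoint_left.1 hdis hzE hzint
  have hAlim : Tendsto (fun k ↦ μ (A k)) atTop (𝓝 0) := by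
    have := tendsto_measure_iInter_atTop (μ := μ) (fun k ↦ (hAm k).nullMeasurableSet) hAanti
      ⟨0, measure_ne_top μ _⟩
    rw [hAnull] at this
    exact this
  have hbound : ∀ k, ν F ≤ μ F + μ (A k) := fun k ↦
    calc ν F ≤ μ (Fk k) := hνle k
      _ ≤ μ (F ∪ A k) := measure_mono fun γ hγ ↦ by
          by_cases h : γ ∈ F
          · exact Or.inl h
          · exact Or.inr (mem_iUnion₂.2 ⟨k, le_rfl, hγ, h⟩)
      _ ≤ μ F + μ (A k) := measure_union_le _ _
  have hT : Tendsto (fun k ↦ μ F + μ (A k)) atTop (𝓝 (μ F + 0)) :=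
    tendsto_const_nhds.add hAlim
  rw [add_zero] at hT
  exact ge_of_tendsto' hT hbound

/-! ## §4 The item from the two one-sided sequential lattice bounds -/

/-- **THE ITEM FROM TWO ONE-SIDED LATTICE BOUNDS.** `LimitAvoidanceValues` follows from the two halves
of the sequential hull-avoidance limit, along sequences `s n → 0⁺` on which the pushed-forward laws
converge weakly to a probability measure: (LOWER) `Φ_A'(0)^{5/8} ≤ liminf Pₙ(range ⊆ cl D')` and
(UPPER) `limsup Pₙ(range ⊆ cl D') ≤ Φ_A'(0)^{5/8}`, for every inline hull subdomain `D'` and every choice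
of restriction data. The lower half is used at `D'` only (`le_measure_of_le_liminf`),
the upper half through the carved super-domains (`measure_rangeSubset_le_of_limsup_le`, SLE values by
`SLEAvoidanceValue_proof`); the `μ`-free form `limitAvoidanceValues_of_values` assembles them.
[cite: LawlerSchrammWerner2003Restriction, §3 and Thm. 6.1] -/
theorem limitAvoidanceValues_of_oneSided
    (hlow : ∀ (D : DobrushinDomain) (a b : ℝ → Site 2), IsEndpointApprox D a b →
      ∀ (s : ℕ → ℝ) (ν : Measure (CurveClass ℂ)), Tendsto s atTop (𝓝[>] (0 : ℝ)) →
        IsProbabilityMeasure ν →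
        (∀ f : CurveClass ℂ →ᵇ ℝ,
          Tendsto (fun n => ∫ γ, f γ.curve ∂(SAW.law D.carrier (s n) (a (s n)) (b (s n)))) atTop
            (𝓝 (∫ x, f x ∂ν))) →
        ∀ D' : DobrushinDomain, D'.carrier ⊆ D.carrier → D'.pt 0 = D.pt 0 → D'.pt 1 = D.pt 1 →
          (∃ ε : ℝ, 0 < ε ∧ D'.carrier ∩ ball (D.pt 0) ε = D.carrier ∩ ball (D.pt 0) ε ∧
            D'.carrier ∩ ball (D.pt 1) ε = D.carrier ∩ ball (D.pt 1) ε) →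
          ∀ (φ : ConformalEquiv upperHalfPlaneSet D.carrier), D.IsChordalUniformizing φ →
            ∀ (A : Set ℂ),
              A = closure (upperHalfPlaneSet \ {z | z ∈ upperHalfPlaneSet ∧ φ z ∈ D'.carrier}) →
              ∀ (Φ : ConformalEquiv (upperHalfPlaneSet \ A) upperHalfPlaneSet) (d : ℝ),
                IsRestrictionMap A Φ → HasRestrictionDeriv A Φ d →
                  ENNReal.ofReal (d ^ ((5 : ℝ) / 8)) ≤
                    liminf (fun n => ((SAW.law D.carrier (s n) (a (s n)) (b (s n))).map
                      (fun γ => γ.curve)) (CurveClass.rangeSubset (closure D'.carrier))) atTop)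
    (hup : ∀ (D : DobrushinDomain) (a b : ℝ → Site 2), IsEndpointApprox D a b →
      ∀ (s : ℕ → ℝ) (ν : Measure (CurveClass ℂ)), Tendsto s atTop (𝓝[>] (0 : ℝ)) →
        IsProbabilityMeasure ν →
        (∀ f : CurveClass ℂ →ᵇ ℝ,
          Tendsto (fun n => ∫ γ, f γ.curve ∂(SAW.law D.carrier (s n) (a (s n)) (b (s n)))) atTop
            (𝓝 (∫ x, f x ∂ν))) →
        ∀ D' : DobrushinDomain, D'.carrier ⊆ D.carrier → D'.pt 0 = D.pt 0 → D'.pt 1 = D.pt 1 →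
          (∃ ε : ℝ, 0 < ε ∧ D'.carrier ∩ ball (D.pt 0) ε = D.carrier ∩ ball (D.pt 0) ε ∧
            D'.carrier ∩ ball (D.pt 1) ε = D.carrier ∩ ball (D.pt 1) ε) →
          ∀ (φ : ConformalEquiv upperHalfPlaneSet D.carrier), D.IsChordalUniformizing φ →
            ∀ (A : Set ℂ),
              A = closure (upperHalfPlaneSet \ {z | z ∈ upperHalfPlaneSet ∧ φ z ∈ D'.carrier}) →
              ∀ (Φ : ConformalEquiv (upperHalfPlaneSet \ A) upperHalfPlaneSet) (d : ℝ),
                IsRestrictionMap A Φ → HasRestrictionDeriv A Φ d →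
                  limsup (fun n => ((SAW.law D.carrier (s n) (a (s n)) (b (s n))).map
                      (fun γ => γ.curve)) (CurveClass.rangeSubset (closure D'.carrier))) atTop ≤
                    ENNReal.ofReal (d ^ ((5 : ℝ) / 8))) :
    LimitAvoidanceValues := by
  refine limitAvoidanceValues_of_values ?_
  intro D a b hab s ν hs hν hw D' hsub h0 h1 hε φ hφ A hA Φ d hΦ hd
  haveI := hν
  refine le_antisymm ?_
    (le_measure_of_le_liminf hw (CurveClass.isClosed_rangeSubset isClosed_closure)
      (hlow D a b hab s ν hs hν hw D' hsub h0 h1 hε φ hφ A hA Φ d hΦ hd))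
  -- the upper half against the SLE(8/3) law, then LSW Thm 6.1 for its value
  obtain ⟨Γ, hΓ⟩ := exists_isSLECurve_eightThirds D
  have hμ := hΓ.isSLELaw_map
  rw [← SLEAvoidanceValue_proof D D' _ hμ hsub h0 h1 hε φ hφ A hA Φ d hΦ hd]
  refine measure_rangeSubset_le_of_limsup_le hab hs hw hμ ?_ hsub h0 h1
  intro D'' hsub'' h0'' h1'' hε''
  obtain ⟨φ'', hφ'', Φ'', d'', hΦ'', hd'', -, -⟩ := exists_restrictionData D D'' hsub'' h0'' h1'' hε''
  rw [SLEAvoidanceValue_proof D D'' _ hμ hsub'' h0'' h1'' hε'' φ'' hφ'' _ rfl Φ'' d'' hΦ'' hd'']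
  exact hup D a b hab s ν hs hν hw D'' hsub'' h0'' h1'' hε'' φ'' hφ'' _ rfl Φ'' d'' hΦ'' hd''

/-- **Both one-sided bounds from `AvoidanceLimit`** (stmt-CriticalPhenomena-10649): a limit along the
full filter `δ → 0⁺` bounds `liminf` from below and `limsup` from above along every sequence
`s n → 0⁺`. [folklore] -/
theorem oneSided_of_avoidanceLimit (hA : AvoidanceLimit) {D D' : DobrushinDomain} {a b : ℝ → Site 2}
    (hab : IsEndpointApprox D a b) {s : ℕ → ℝ} (hs : Tendsto s atTop (𝓝[>] (0 : ℝ)))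
    (hsub : D'.carrier ⊆ D.carrier) (h0 : D'.pt 0 = D.pt 0) (h1 : D'.pt 1 = D.pt 1)
    (hε : ∃ ε : ℝ, 0 < ε ∧ D'.carrier ∩ ball (D.pt 0) ε = D.carrier ∩ ball (D.pt 0) ε ∧
      D'.carrier ∩ ball (D.pt 1) ε = D.carrier ∩ ball (D.pt 1) ε)
    (φ : ConformalEquiv upperHalfPlaneSet D.carrier) (hφ : D.IsChordalUniformizing φ)
    (A : Set ℂ) (hAeq : A = closure (upperHalfPlaneSet \ {z | z ∈ upperHalfPlaneSet ∧ φ z ∈ D'.carrier}))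
    (Φ : ConformalEquiv (upperHalfPlaneSet \ A) upperHalfPlaneSet) (d : ℝ)
    (hΦ : IsRestrictionMap A Φ) (hd : HasRestrictionDeriv A Φ d) :
    ENNReal.ofReal (d ^ ((5 : ℝ) / 8)) ≤
        liminf (fun n => ((SAW.law D.carrier (s n) (a (s n)) (b (s n))).map
          (fun γ => γ.curve)) (CurveClass.rangeSubset (closure D'.carrier))) atTop ∧
      limsup (fun n => ((SAW.law D.carrier (s n) (a (s n)) (b (s n))).map
          (fun γ => γ.curve)) (CurveClass.rangeSubset (closure D'.carrier))) atTop ≤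
        ENNReal.ofReal (d ^ ((5 : ℝ) / 8)) := by
  have h := (hA D D' a b hab hsub h0 h1 hε φ hφ A hAeq Φ d hΦ hd).comp hs
  exact ⟨h.liminf_eq.ge, h.limsup_eq.le⟩

end Summit.CriticalPhenomena.SAWScalingLimit.Theorems.LimitAvoidanceValues

end
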